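import Summits.QuantumFields.BalabanUV.Beta.D1BFx.BlockColumnSupNorm

/-!
# `BalabanUV.Beta.D1BFx.PointColumnSplit` — road «BF-x» for binder row D1, sub-leaf **L2-gh** (part 1 of 3):
# THE FREE-LEG SPLIT OF THE B4-Sect.5 WHOLE-LATTICE KERNEL `G′ = (Δ^η + aQ′*Q′)⁻¹` ON `ℤ^d`:
# `G′(p,q) = η²·G₀(p−q) − a·η^{d+2}·Σ_y S_q(y)·(G′Q′*)(p,y)` EXACTLY, hence `|G′(p,q) − η²G₀(p−q)| ≤ K(d,a)·η^d` and
# `|∇_p(G′ − η²G₀)| ≤ K(d,a)·η^{d+1}` UNIFORMLY (`η = 1/(n+1)`, `G₀ = latticeGreen/2`, `d ≥ 3`)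

HONEST FRAMING (cell contract, verbatim): «discharging `BetaPertH` makes Bałaban's UV stability UNCONDITIONAL — a real constructive-QFT
result; it is NOT the continuum limit and NOT the Clay problem.»  HONEST DEPENDENCY (verbatim): «continuum YM on T⁴ ⇐ BetaPertH ∧ nine
spine estimates (0/9 proved); BetaPertH ⇐ (D1) ∧ (D4) ∧ CAP+tail; G-an2-4 gates asym, D1 and NE2/3/4.»  THIS MODULE DISCHARGES NOTHING of
that: elementary potential theory on `ℤ^d` (kernel-checked, [folklore]) for ONE leg species (the ghost leg `Ggh = Gk (n−1)` of T2) of ONE road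
(BF-x) to ONE conjunct (D1).  0 wall binders instantiated; NOT A2′/A1.ii, NOT D1, NOT BetaPertH, NOT continuum, NOT Clay.
ABSOLUTE RULE (cell, verbatim): «No internally-minted statement may enter as a cited fact. Every hypothesis is either kernel-proved in this
package or a verbatim quotation of a PUBLISHED theorem with page reference.»  Nothing printed is asserted or cited; every theorem is proved
outright from pv23-g7's `B5Hk103ScalarZd` (`Gk`, `gq`, `tsum_AX_mul`, `tsum_Gk_mul_AX`, `tsum_mul_tsum_comm`, `tsum_blocks`, `abs_Gk_le`),
pv23's `B6QGQLower276` (`AX`, `abs_AX_le`, block charts), pv23-g4's `Beta/PoissonInterior` (`G₀`, `lap_G₀`, `G₀_bound`, `nrm`, `cube`,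
`sum_cube_inv_nrm_pow_le`), lit1's `LatticeLaplacianZd` (`latticeLaplacianZd_comp_add`) and parts 1–2 of A3.a-P (`BlockColumnPoisson.lap_eq_neg_tsum_lapKer`,
`BlockColumnSupNorm.abs_gq_le_sup`/`abs_gq_diff_le_sup` — THE MESH-FREE COLUMN LEGS ARE THE INPUT); constants/objects with bodies only (no `def … : Prop`).

WHY (skeleton `HOME/beta/skeletons/D1-b2b-balaban-beta-d1-p2.md` v1.4 node L2 «GHOST LEG … Owed: … A2′ (re-legging the ghost sector onto the gluon
diagonal … both being `gFree + O(n⁻²)`-graded)»; A2′ `D1BFx/GhostRelegging` (swarm leaf-10) takes the six scalar rows `h0/h1/h2/d0/d1/d2` of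
`SquareTable.oneLoopDrift_of_scalarBounds_avg` as HYPOTHESES for BOTH leg families; `A0-TERM-CENSUS.md` rows MAIN-gh / gh-corr).  In the wall's
leg units `Gf n b v = n²·Ggh n a (b+v) b`, row h0 reads `|n²·Gk (n−1) a (b+v) b − G₀ v| ≤ D₀/n²` and row h1 the same for first differences with
`D₁/n³`: this file proves the general-`d` statements behind them (part 3 `D1BFx/GhostLegFree` packages the `d = 4` rows; part 2
`D1BFx/PointColumnDecay` the far-field rows d0/d1).

THE ROUTE ([folklore]; `d ≥ 3`, mesh `n : ℕ` arbitrary, `a > 0`).  §1 BLOCK SUMS OF NEWTON POTENTIALS: a block of side `n+1` carries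
`Σ_{r∈B(y)} nrm(r−q)^{−e} ≤ c(d,e)·(n+1)^{d−e}` for `e ≤ d−1`, uniformly in the block and the pole (`sum_block_inv_nrm_pow_le`: near blocks by
`PoissonInterior.sum_cube_inv_nrm_pow_le` on the cube of radius `2(n+1)`, far blocks termwise).  §2 `cG0 d` (the `C₀` of `G₀_bound`, chosen once),
the BLOCK POTENTIAL `blockPot n q y := Σ_{r∈B(y)} G₀(r−q)` and `|blockPot| ≤ cG0·c·(n+1)²`.  §3 THE SECOND RESOLVENT IDENTITY: the row action of the
site matrix `A = (n+1)²(−Δ) + a(n+1)^{−d}1[same block]` on ANY function (`tsum_AX_mul_eq`), `G′·(A h) = h` for BOUNDED `h` (Fubini under the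
exponential majorant, `tsum_Gk_AX_apply`), applied to `h = G₀(·−q)` (`A h = (n+1)²δ_q + a(n+1)^{−d}·blockPot(blk ·)`, `lap_G₀`):
**`Gk_eq_free_sub`** `Gk n a p q = G₀(p−q)/(n+1)² − a/(n+1)^{d+2}·Σ'_y blockPot n q y · gq n a p y` — no uniqueness argument, no limit.
§4 THE BOUNDS: with `abs_gq_le_sup` (value) and `abs_gq_diff_le_sup` (forward difference — the difference falls on the COLUMN, not on `G₀`):
**`abs_Gk_sub_free_le`** `|Gk n a p q − G₀(p−q)/(n+1)²| ≤ cSplit(d,a)/(n+1)^d` and **`abs_Gk_diff_sub_free_le`**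
`|(Gk n a (p+e_μ) q − Gk n a p q) − (G₀(p+e_μ−q) − G₀(p−q))/(n+1)²| ≤ cSplit(d,a)/(n+1)^{d+1}`, `cSplit = a·cG0·c·cG·K_d(δ_u)`.
HONEST SCOPE: scalar `U = 1`, whole lattice, `d ≥ 3`; constants existential in `d` (`cG0`, and `cI` inside `cG`); ONE forward difference (second
differences: see part 3's flag); no statement about the torus or about the vector leg `Ga`.
-/

namespace Summit.QuantumFields.BalabanUV.Beta.D1BFx.PointColumnSplit

open Finset Real
open Literature.MathematicalPhysics.QuantumFieldTheory.Balaban1983to89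
open Literature.Probability.LatticeModels (latticeLaplacianZd latticeLaplacianZd_comp_add)
open B4Sect5Proof (latticeConst latticeConst_nonneg)
open B6QGQLower276 (X e blk B mem_B B_disjoint sum_B_const side side_facts side_mul_blk_add_loc loc loc_nonneg loc_le
  lapKer sameBlk AX abs_AX_le c0 c0_pos)
open B6QGQDecay237 (cU deltaU cU_pos deltaU_pos deltaU_le_one)
open B5Hk103ScalarZd (Gk gq abs_Gk_le tsum_AX_mul tsum_Gk_mul_AX tsum_mul_tsum_comm tsum_blocks nbhd lapKer_eq_zero_of_not_mem
  summable_expX tsum_expX_le summable_Gk_row)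
open Beta.PoissonInterior (cube mem_cube mem_cube_zero_iff supNorm nrm one_le_nrm nrm_pos supNorm_le_nrm natAbs_le_supNorm
  G₀ lap_G₀ G₀_bound sum_cube_inv_nrm_pow_le)
open RProjector (abs_tsum_le_latticeConst)
open BlockColumnPoisson (lap_eq_neg_tsum_lapKer)
open BlockColumnSupNorm (cG cG_pos abs_gq_le_sup abs_gq_diff_le_sup)

noncomputable section

variable {d : ℕ}

/-! ## §1 Block sums of Newton-potential envelopes -/

/-- [our object] The block-sum constant `cKL(d,e) = 2 + 2d·3^{d−1}·2^{d−e}`. -/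
def cKL (d e : ℕ) : ℝ := 2 + 2 * d * 3 ^ (d - 1) * 2 ^ (d - e)

/-- [folklore] `cKL d e ≥ 1`. -/
theorem one_le_cKL (d e : ℕ) : 1 ≤ cKL d e := by
  unfold cKL; have : (0 : ℝ) ≤ 2 * d * 3 ^ (d - 1) * 2 ^ (d - e) := by positivity
  linarith

/-- [folklore] A site of a block FAR from the block of the pole (some block coordinate differs by `≥ 2`) is at sup-distance `≥ n+1`
from the pole: `nrm (r − q) ≥ n + 1`. -/
theorem nrm_ge_of_far_block {n : ℕ} {y q r : X d} (hr : r ∈ B n y) {i : Fin d} (hi : 2 ≤ |y i - blk n q i|) :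
    ((n : ℝ) + 1) ≤ nrm (r - q) := by
  have hs := side_mul_blk_add_loc n r i
  have hq := side_mul_blk_add_loc n q i
  rw [mem_B.1 hr] at hs
  have h1 := loc_nonneg n r i; have h2 := loc_le n r i
  have h3 := loc_nonneg n q i; have h4 := loc_le n q i
  have hside : side n = (n : ℤ) + 1 := rfl
  have key : (n : ℤ) + 1 ≤ |r i - q i| := by
    have e1 : r i - q i = side n * (y i - blk n q i) + (loc n r i - loc n q i) := by rw [← hs, ← hq]; ring
    rw [e1, hside]
    rcases le_abs.1 hi with h | h
    · rw [le_abs]; left; nlinarith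
    · rw [le_abs]; right; nlinarith
  have hnat : n + 1 ≤ ((r - q) i).natAbs := by
    have : ((n + 1 : ℕ) : ℤ) ≤ |(r - q) i| := by push_cast; simpa using key
    rw [← Int.natCast_natAbs] at this
    exact_mod_cast this
  have h5 : n + 1 ≤ supNorm (r - q) := hnat.trans (natAbs_le_supNorm _ i)
  calc ((n : ℝ) + 1) = ((n + 1 : ℕ) : ℝ) := by push_cast; ring
    _ ≤ (supNorm (r - q) : ℝ) := by exact_mod_cast h5
    _ ≤ nrm (r - q) := supNorm_le_nrm _

/-- [folklore] A site of a block ADJACENT to the block of the pole lies in the cube of radius `2(n+1)` about the pole. -/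
theorem sub_mem_cube_of_near_block {n : ℕ} {y q r : X d} (hr : r ∈ B n y) (hy : dist y (blk n q) ≤ 1) :
    r - q ∈ cube (0 : X d) (2 * (n + 1)) := by
  rw [mem_cube]
  intro i
  have hs := side_mul_blk_add_loc n r i
  have hq := side_mul_blk_add_loc n q i
  rw [mem_B.1 hr] at hs
  have h1 := loc_nonneg n r i; have h2 := loc_le n r i
  have h3 := loc_nonneg n q i; have h4 := loc_le n q i
  have hside : side n = (n : ℤ) + 1 := rfl
  have hyi : |y i - blk n q i| ≤ 1 := by
    have h := (dist_le_pi_dist y (blk n q) i).trans hy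
    rw [Int.dist_eq] at h
    exact_mod_cast h
  have e1 : (r - q) i - (0 : X d) i = side n * (y i - blk n q i) + (loc n r i - loc n q i) := by
    simp only [Pi.sub_apply, Pi.zero_apply, sub_zero]; rw [← hs, ← hq]; ring
  rw [e1, hside]
  rw [abs_le] at hyi ⊢
  push_cast
  constructor <;> nlinarith

/-- [folklore] **BLOCK SUMS OF NEWTON-POTENTIAL ENVELOPES**: for `e ≤ d − 1`, every block `B(y)` of side `n+1` and every pole `q`,
`Σ_{r∈B(y)} nrm(r−q)^{−e} ≤ cKL(d,e)·(n+1)^{d−e}` (near blocks: the cube of radius `2(n+1)` about the pole; far blocks: termwise `nrm ≥ n+1`). -/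
theorem sum_block_inv_nrm_pow_le (hd : 0 < d) {e : ℕ} (he : e ≤ d - 1) (n : ℕ) (y q : X d) :
    ∑ r ∈ B n y, 1 / nrm (r - q) ^ e ≤ cKL d e * ((n : ℝ) + 1) ^ (d - e) := by
  classical
  have hs0 : (0 : ℝ) < (n : ℝ) + 1 := by positivity
  have hpow1 : (1 : ℝ) ≤ ((n : ℝ) + 1) ^ (d - e) := one_le_pow₀ (by linarith)
  have hK0 : (0 : ℝ) ≤ 2 * d * 3 ^ (d - 1) * 2 ^ (d - e) := by positivity
  by_cases hy : dist y (blk n q) ≤ 1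
  · -- near block: inject into the cube of radius `2(n+1)` about the pole
    have hinj : Set.InjOn (fun r : X d => r - q) ↑(B n y) := fun r _ r' _ h => sub_left_injective h
    calc ∑ r ∈ B n y, 1 / nrm (r - q) ^ e = ∑ z ∈ (B n y).image (fun r => r - q), 1 / nrm z ^ e := by
          rw [Finset.sum_image hinj]
      _ ≤ ∑ z ∈ cube (0 : X d) (2 * (n + 1)), 1 / nrm z ^ e := by
          refine Finset.sum_le_sum_of_subset_of_nonneg ?_ fun z _ _ => by have := nrm_pos z; positivity
          intro z hz
          obtain ⟨r, hr, rfl⟩ := Finset.mem_image.1 hz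
          exact sub_mem_cube_of_near_block hr hy
      _ ≤ 1 + 2 * d * 3 ^ (d - 1) * ((2 * (n + 1) : ℕ) : ℝ) ^ (d - e) := sum_cube_inv_nrm_pow_le hd _ e he
      _ = 1 + 2 * d * 3 ^ (d - 1) * 2 ^ (d - e) * ((n : ℝ) + 1) ^ (d - e) := by push_cast; rw [mul_pow]; ring
      _ ≤ cKL d e * ((n : ℝ) + 1) ^ (d - e) := by unfold cKL; nlinarith
  · -- far block: some block coordinate differs by `≥ 2`, every term is `≤ (n+1)^{−e}`
    have hfar : ∃ i, 2 ≤ |y i - blk n q i| := by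
      by_contra hcon
      push Not at hcon
      apply hy
      refine (dist_pi_le_iff zero_le_one).2 fun i => ?_
      rw [Int.dist_eq]
      have : |y i - blk n q i| ≤ 1 := by have := hcon i; omega
      exact_mod_cast this
    obtain ⟨i, hi⟩ := hfar
    have hterm : ∀ r ∈ B n y, 1 / nrm (r - q) ^ e ≤ 1 / ((n : ℝ) + 1) ^ e := by
      intro r hr
      have h := nrm_ge_of_far_block hr hi
      exact one_div_le_one_div_of_le (pow_pos hs0 e) (pow_le_pow_left₀ hs0.le h e)
    calc ∑ r ∈ B n y, 1 / nrm (r - q) ^ e ≤ ∑ _r ∈ B n y, 1 / ((n : ℝ) + 1) ^ e := Finset.sum_le_sum hterm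
      _ = ((n : ℝ) + 1) ^ d * (1 / ((n : ℝ) + 1) ^ e) := sum_B_const _ _
      _ = ((n : ℝ) + 1) ^ (d - e) := by
          rw [one_div, ← div_eq_mul_inv, pow_sub₀ _ hs0.ne' (show e ≤ d by omega), div_eq_mul_inv]
      _ ≤ cKL d e * ((n : ℝ) + 1) ^ (d - e) := by
          have := one_le_cKL d e
          exact le_mul_of_one_le_left (by positivity) this

/-! ## §2 The free leg's envelope constant and the block potential -/

/-- [our object] **The envelope constant `C₀(d)` of the free leg** (`PoissonInterior.G₀_bound`, chosen once by `Classical.choose`; `0` for `d < 3`). -/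
def cG0 (d : ℕ) : ℝ := if h : 3 ≤ d then Classical.choose (G₀_bound (d := d) h) else 0

/-- [folklore] `cG0 d ≥ 0`. -/
theorem cG0_nonneg (d : ℕ) : 0 ≤ cG0 d := by
  unfold cG0; split_ifs with h
  · exact (Classical.choose_spec (G₀_bound (d := d) h)).1
  · exact le_rfl

/-- [folklore] The free-leg envelope with the named constant: `|G₀ v| ≤ cG0 d / nrm v^{d−2}`. -/
theorem abs_G₀_le (hd : 3 ≤ d) (v : X d) : |G₀ v| ≤ cG0 d / nrm v ^ (d - 2) := by
  have h := (Classical.choose_spec (G₀_bound (d := d) hd)).2 v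
  have e1 : cG0 d = Classical.choose (G₀_bound (d := d) hd) := by unfold cG0; rw [dif_pos hd]
  rw [e1]; exact h

/-- [folklore] `|G₀ v| ≤ cG0 d` (the envelope at `nrm ≥ 1`). -/
theorem abs_G₀_le_const (hd : 3 ≤ d) (v : X d) : |G₀ v| ≤ cG0 d := by
  refine (abs_G₀_le hd v).trans (div_le_self (cG0_nonneg d) (one_le_pow₀ (one_le_nrm v)))

/-- [our object] **The block potential of the free leg**: `blockPot n q y := Σ_{r∈B(y)} G₀(r − q)` — the free leg of the pole `q` summed over the
block `B(y)` (it is what the block term `a(n+1)^{−d}1[same block]` of the site matrix makes of `G₀(·−q)`). -/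
def blockPot (n : ℕ) (q y : X d) : ℝ := ∑ r ∈ B n y, G₀ (r - q)

/-- [folklore] **`|blockPot n q y| ≤ cG0(d)·cKL(d,d−2)·(n+1)²`**, uniformly in the block and the pole. -/
theorem abs_blockPot_le (hd : 3 ≤ d) (n : ℕ) (q y : X d) :
    |blockPot n q y| ≤ cG0 d * cKL d (d - 2) * ((n : ℝ) + 1) ^ 2 := by
  have hd0 : 0 < d := by omega
  unfold blockPot
  refine (Finset.abs_sum_le_sum_abs _ _).trans ?_
  calc ∑ r ∈ B n y, |G₀ (r - q)| ≤ ∑ r ∈ B n y, cG0 d * (1 / nrm (r - q) ^ (d - 2)) :=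
        Finset.sum_le_sum fun r _ => (abs_G₀_le hd (r - q)).trans (le_of_eq (by ring))
    _ = cG0 d * ∑ r ∈ B n y, 1 / nrm (r - q) ^ (d - 2) := by rw [Finset.mul_sum]
    _ ≤ cG0 d * (cKL d (d - 2) * ((n : ℝ) + 1) ^ (d - (d - 2))) :=
        mul_le_mul_of_nonneg_left (sum_block_inv_nrm_pow_le hd0 (by omega) n y q) (cG0_nonneg d)
    _ = cG0 d * cKL d (d - 2) * ((n : ℝ) + 1) ^ 2 := by rw [show d - (d - 2) = 2 by omega]; ring

/-! ## §3 The second resolvent identity `G′ = η²G₀ − G′·(a η^{d+2} Π G₀)` -/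

/-- [folklore] **The row action of the site matrix on ANY function**: `Σ'_s A(r,s) h(s) = −(n+1)²·Δh(r) + a(n+1)^{−d}·Σ_{s∈B(blk r)} h(s)`
(finite row: no summability needed). -/
theorem tsum_AX_mul_eq (n : ℕ) (a : ℝ) (r : X d) (h : X d → ℝ) :
    ∑' s : X d, AX n a r s * h s
      = -(((n : ℝ) + 1) ^ 2 * latticeLaplacianZd h r) + a / ((n : ℝ) + 1) ^ d * ∑ s ∈ B n (blk n r), h s := by
  classical
  have hsuppL : ∀ s ∉ nbhd n r, (((n : ℝ) + 1) ^ 2 * lapKer r s) * h s = 0 := by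
    intro s hs; rw [lapKer_eq_zero_of_not_mem hs, mul_zero, zero_mul]
  have hsuppB : ∀ s ∉ B n (blk n r), (a / ((n : ℝ) + 1) ^ d * sameBlk n r s) * h s = 0 := by
    intro s hs
    have : sameBlk n r s = 0 := by rw [sameBlk, if_neg]; exact fun h' => hs (mem_B.2 h'.symm)
    rw [this, mul_zero, zero_mul]
  have hsL : Summable fun s : X d => (((n : ℝ) + 1) ^ 2 * lapKer r s) * h s := summable_of_ne_finset_zero hsuppL
  have hsB : Summable fun s : X d => (a / ((n : ℝ) + 1) ^ d * sameBlk n r s) * h s := summable_of_ne_finset_zero hsuppB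
  have hsplit : ∑' s : X d, AX n a r s * h s
      = ∑' s : X d, (((n : ℝ) + 1) ^ 2 * lapKer r s) * h s + ∑' s : X d, (a / ((n : ℝ) + 1) ^ d * sameBlk n r s) * h s := by
    rw [← hsL.tsum_add hsB]
    refine tsum_congr fun s => ?_
    rw [AX]; ring
  have hlap : ∑' s : X d, (((n : ℝ) + 1) ^ 2 * lapKer r s) * h s = -(((n : ℝ) + 1) ^ 2 * latticeLaplacianZd h r) := by
    rw [lap_eq_neg_tsum_lapKer, mul_neg, neg_neg, ← tsum_mul_left]
    refine tsum_congr fun s => ?_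
    ring
  have hblock : ∑' s : X d, (a / ((n : ℝ) + 1) ^ d * sameBlk n r s) * h s = a / ((n : ℝ) + 1) ^ d * ∑ s ∈ B n (blk n r), h s := by
    rw [tsum_eq_sum (s := B n (blk n r)) hsuppB, Finset.mul_sum]
    refine Finset.sum_congr rfl fun s hs => ?_
    have : sameBlk n r s = 1 := by rw [sameBlk, if_pos (mem_B.1 hs).symm]
    rw [this]; ring
  rw [hsplit, hlap, hblock]

/-- [folklore] **`G′·(A h) = h` for every BOUNDED `h`** on `ℤ^d`: `Σ'_r G′(p,r)·(Σ'_s A(r,s)h(s)) = h(p)` — Fubini under the majorant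
`(2/min(2,a))e^{−δ_u|p−r|/(n+1)}·c₀e^{−|r−s|}·H` (pv23-g7's `tsum_mul_tsum_comm`), then `G′A = 1` entrywise (`tsum_Gk_mul_AX`). -/
theorem tsum_Gk_AX_apply (n : ℕ) {a : ℝ} (ha : 0 < a) (p : X d) (h : X d → ℝ) {H : ℝ} (hH : ∀ s, |h s| ≤ H) :
    ∑' r : X d, Gk n a p r * ∑' s : X d, AX n a r s * h s = h p := by
  classical
  have hα : 0 < deltaU d a / ((n : ℝ) + 1) := div_pos (deltaU_pos d ha) (by positivity)
  have hH0 : 0 ≤ H := (abs_nonneg _).trans (hH p)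
  have hswap := tsum_mul_tsum_comm (f := fun r => Gk n a p r) (g := fun r s => AX n a r s * h s)
    (C := 2 / min 2 a * c0 d n a * H) hα one_pos p (fun r s => by
      rw [abs_mul, abs_mul]
      have h1 := abs_Gk_le n ha p r
      have h2 := abs_AX_le n a r s
      have h3 := hH s
      have hσ : 0 < 2 / min 2 a := div_pos two_pos (lt_min two_pos ha)
      have hc := c0_pos d n ha.ne'
      have e1 : Real.exp (-(deltaU d a * (dist p r / ((n : ℝ) + 1)))) = Real.exp (-(deltaU d a / ((n : ℝ) + 1) * dist p r)) := by
        congr 1; ring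
      rw [e1] at h1
      calc |Gk n a p r| * (|AX n a r s| * |h s|)
          ≤ (2 / min 2 a * Real.exp (-(deltaU d a / ((n : ℝ) + 1) * dist p r)))
              * ((c0 d n a * Real.exp (-(1 * dist r s))) * H) :=
            mul_le_mul h1 (mul_le_mul h2 h3 (abs_nonneg _) (by positivity)) (by positivity) (by positivity)
        _ = 2 / min 2 a * c0 d n a * H * Real.exp (-(deltaU d a / ((n : ℝ) + 1) * dist p r))
              * Real.exp (-(1 * dist r s)) := by ring)
  rw [hswap]
  have hinner : ∀ s : X d, ∑' r : X d, Gk n a p r * (AX n a r s * h s) = (if p = s then 1 else 0) * h s := by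
    intro s
    rw [← tsum_Gk_mul_AX n ha p s, ← tsum_mul_right]
    refine tsum_congr fun r => ?_
    ring
  rw [tsum_congr hinner, tsum_eq_single p (fun s hs => by rw [if_neg (Ne.symm hs), zero_mul]), if_pos rfl, one_mul]

/-- [folklore] **The site matrix applied to the free leg of the pole `q`**: `Σ'_s A(r,s)·G₀(s−q) = (n+1)²·δ_{rq} + a(n+1)^{−d}·blockPot n q (blk r)`
(`lap_G₀`: `Δ G₀(·−q) = −δ_q`). -/
theorem tsum_AX_mul_free (hd : 3 ≤ d) (n : ℕ) (a : ℝ) (r q : X d) :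
    ∑' s : X d, AX n a r s * G₀ (s - q)
      = ((n : ℝ) + 1) ^ 2 * (if r = q then 1 else 0) + a / ((n : ℝ) + 1) ^ d * blockPot n q (blk n r) := by
  rw [tsum_AX_mul_eq, blockPot]
  have hlap : latticeLaplacianZd (fun s : X d => G₀ (s - q)) r = -(if r = q then 1 else 0) := by
    have h := latticeLaplacianZd_comp_add (G₀ (d := d)) (-q) r
    simp only [← sub_eq_add_neg] at h
    rw [h, lap_G₀ hd]
    simp only [sub_eq_zero]
  rw [hlap]; ring

/-- [folklore] `r ↦ G′(p,r)·blockPot n q (blk r)` is summable (exponential majorant of `G′`, bounded block potential). -/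
theorem summable_Gk_mul_blockPot (hd : 3 ≤ d) (n : ℕ) {a : ℝ} (ha : 0 < a) (p q : X d) :
    Summable fun r : X d => Gk n a p r * blockPot n q (blk n r) := by
  refine Summable.of_norm_bounded ((summable_Gk_row n ha p).abs.mul_right (cG0 d * cKL d (d - 2) * ((n : ℝ) + 1) ^ 2)) fun r => ?_
  rw [Real.norm_eq_abs, abs_mul]
  exact mul_le_mul_of_nonneg_left (abs_blockPot_le hd n q (blk n r)) (abs_nonneg _)

/-- [folklore] **THE SECOND RESOLVENT IDENTITY — FREE-LEG SPLIT OF THE WHOLE-LATTICE KERNEL**: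
`Gk n a p q = G₀(p−q)/(n+1)² − a/(n+1)^{d+2}·Σ'_y blockPot n q y · (G′Q′*)(p,y)` — exact, every mesh, every `a > 0`, `d ≥ 3`. -/
theorem Gk_eq_free_sub (hd : 3 ≤ d) (n : ℕ) {a : ℝ} (ha : 0 < a) (p q : X d) :
    Gk n a p q = G₀ (p - q) / ((n : ℝ) + 1) ^ 2
      - a / ((n : ℝ) + 1) ^ (d + 2) * ∑' y : X d, blockPot n q y * gq n a p y := by
  classical
  have hs0 : (0 : ℝ) < ((n : ℝ) + 1) ^ 2 := by positivity
  have hsd : (0 : ℝ) < ((n : ℝ) + 1) ^ d := by positivity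
  -- `G′·(A G₀(·−q)) = G₀(·−q)` at `p`
  have hmain := tsum_Gk_AX_apply n ha p (fun s => G₀ (s - q)) (fun s => abs_G₀_le_const hd (s - q))
  simp only [tsum_AX_mul_free hd n a] at hmain
  -- split the left side into the `δ` part and the block part
  have hsum1 : Summable fun r : X d => Gk n a p r * (((n : ℝ) + 1) ^ 2 * (if r = q then (1 : ℝ) else 0)) :=
    summable_of_ne_finset_zero (s := {q}) (fun r hr => by
      rw [Finset.mem_singleton] at hr; rw [if_neg hr, mul_zero, mul_zero])
  have hsum2 : Summable fun r : X d => Gk n a p r * (a / ((n : ℝ) + 1) ^ d * blockPot n q (blk n r)) := by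
    have h := (summable_Gk_mul_blockPot hd n ha p q).mul_left (a / ((n : ℝ) + 1) ^ d)
    refine h.congr fun r => ?_
    ring
  have hsplit : ∑' r : X d, Gk n a p r * (((n : ℝ) + 1) ^ 2 * (if r = q then (1 : ℝ) else 0)
        + a / ((n : ℝ) + 1) ^ d * blockPot n q (blk n r))
      = ((n : ℝ) + 1) ^ 2 * Gk n a p q + a / ((n : ℝ) + 1) ^ d * ∑' r : X d, Gk n a p r * blockPot n q (blk n r) := by
    have e1 : ∀ r : X d, Gk n a p r * (((n : ℝ) + 1) ^ 2 * (if r = q then (1 : ℝ) else 0)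
        + a / ((n : ℝ) + 1) ^ d * blockPot n q (blk n r))
        = Gk n a p r * (((n : ℝ) + 1) ^ 2 * (if r = q then (1 : ℝ) else 0))
          + Gk n a p r * (a / ((n : ℝ) + 1) ^ d * blockPot n q (blk n r)) := fun r => by ring
    rw [tsum_congr e1, hsum1.tsum_add hsum2]
    congr 1
    · rw [tsum_eq_single q (fun r hr => by rw [if_neg hr, mul_zero, mul_zero]), if_pos rfl]; ring
    · rw [← tsum_mul_left]; refine tsum_congr fun r => ?_; ring
  rw [hsplit] at hmain
  -- regroup the block part by blocks: `Σ'_r G′(p,r)·blockPot(blk r) = Σ'_y blockPot(y)·(G′Q′*)(p,y)`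
  have hblocks : ∑' r : X d, Gk n a p r * blockPot n q (blk n r) = ∑' y : X d, blockPot n q y * gq n a p y := by
    rw [← tsum_blocks n (summable_Gk_mul_blockPot hd n ha p q)]
    refine tsum_congr fun y => ?_
    rw [gq, Finset.mul_sum]
    refine Finset.sum_congr rfl fun r hr => ?_
    rw [mem_B.1 hr]; ring
  rw [hblocks] at hmain
  -- solve for `Gk n a p q`
  rw [eq_sub_iff_add_eq, eq_div_iff hs0.ne', ← hmain, pow_add]
  field_simp

/-! ## §4 The near-field bounds: `G′ = η²G₀ + O(η^d)`, `∇(G′ − η²G₀) = O(η^{d+1})` -/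

/-- [our object] **The free-split constant** `cSplit(d,a) = a·cG0(d)·cKL(d,d−2)·cG(d,a)·K_d(δ_u)`. -/
def cSplit (d : ℕ) (a : ℝ) : ℝ := a * (cG0 d * cKL d (d - 2)) * cG d a * latticeConst d (deltaU d a)

/-- [folklore] `cSplit d a ≥ 0`. -/
theorem cSplit_nonneg (d : ℕ) {a : ℝ} (ha : 0 < a) : 0 ≤ cSplit d a := by
  unfold cSplit; have := cG0_nonneg d; have := one_le_cKL d (d - 2); have := cG_pos d ha
  have := latticeConst_nonneg d (deltaU_pos d ha).le; positivity

/-- [folklore] The correction series against ANY column envelope `|c y| ≤ M e^{−δ_u|blk p − y|}`: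
`|Σ'_y blockPot n q y · c y| ≤ cG0·cKL·(n+1)²·M·K_d(δ_u)`. -/
theorem abs_tsum_blockPot_mul_le (hd : 3 ≤ d) (n : ℕ) {a : ℝ} (ha : 0 < a) (p q : X d) {c : X d → ℝ} {M : ℝ} (hM : 0 ≤ M)
    (hc : ∀ y, |c y| ≤ M * Real.exp (-(deltaU d a * dist (blk n p) y))) :
    |∑' y : X d, blockPot n q y * c y| ≤ cG0 d * cKL d (d - 2) * ((n : ℝ) + 1) ^ 2 * M * latticeConst d (deltaU d a) := by
  have hB := abs_blockPot_le hd n q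
  have hK : 0 ≤ cG0 d * cKL d (d - 2) * ((n : ℝ) + 1) ^ 2 := by
    have := cG0_nonneg d; have := one_le_cKL d (d - 2); positivity
  refine abs_tsum_le_latticeConst (deltaU_pos d ha) (by positivity) (blk n p) fun y => ?_
  rw [abs_mul]
  calc |blockPot n q y| * |c y| ≤ (cG0 d * cKL d (d - 2) * ((n : ℝ) + 1) ^ 2) * (M * Real.exp (-(deltaU d a * dist (blk n p) y))) :=
        mul_le_mul (hB y) (hc y) (abs_nonneg _) hK
    _ = _ := by ring

/-- [folklore] **`G′ = η²·G₀ + O(η^d)` UNIFORMLY**: `|Gk n a p q − G₀(p−q)/(n+1)²| ≤ cSplit(d,a)/(n+1)^d` for all `p, q ∈ ℤ^d`, every mesh `n`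
(`d ≥ 3`, `a > 0`) — the free leg carries the whole `η²|p−q|^{2−d}` singularity; the remainder is smaller by the block volume. -/
theorem abs_Gk_sub_free_le (hd : 3 ≤ d) (n : ℕ) {a : ℝ} (ha : 0 < a) (p q : X d) :
    |Gk n a p q - G₀ (p - q) / ((n : ℝ) + 1) ^ 2| ≤ cSplit d a / ((n : ℝ) + 1) ^ d := by
  have hs : (0 : ℝ) < (n : ℝ) + 1 := by positivity
  have h := abs_tsum_blockPot_mul_le hd n ha p q (cG_pos d ha).le (fun y => abs_gq_le_sup hd n ha p y)
  rw [Gk_eq_free_sub hd n ha p q, sub_sub_cancel_left, abs_neg, abs_mul, abs_div, abs_of_pos ha, abs_of_pos (pow_pos hs _)]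
  calc a / ((n : ℝ) + 1) ^ (d + 2) * |∑' y : X d, blockPot n q y * gq n a p y|
      ≤ a / ((n : ℝ) + 1) ^ (d + 2) * (cG0 d * cKL d (d - 2) * ((n : ℝ) + 1) ^ 2 * cG d a * latticeConst d (deltaU d a)) :=
        mul_le_mul_of_nonneg_left h (by positivity)
    _ = cSplit d a / ((n : ℝ) + 1) ^ d := by rw [cSplit, pow_add]; field_simp

/-- [folklore] **`∇(G′ − η²G₀) = O(η^{d+1})` UNIFORMLY** (forward difference in the first slot):
`|(Gk n a (p+e_μ) q − Gk n a p q) − (G₀(p+e_μ−q) − G₀(p−q))/(n+1)²| ≤ cSplit(d,a)/(n+1)^{d+1}` — the difference falls on the block column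
(`abs_gq_diff_le_sup`), not on the free leg. -/
theorem abs_Gk_diff_sub_free_le (hd : 3 ≤ d) (n : ℕ) {a : ℝ} (ha : 0 < a) (p q : X d) (μ : Fin d) :
    |(Gk n a (p + e μ) q - Gk n a p q) - (G₀ (p + e μ - q) - G₀ (p - q)) / ((n : ℝ) + 1) ^ 2|
      ≤ cSplit d a / ((n : ℝ) + 1) ^ (d + 1) := by
  have hs : (0 : ℝ) < (n : ℝ) + 1 := by positivity
  have hsum : ∀ p' : X d, Summable fun y : X d => blockPot n q y * gq n a p' y := by
    intro p'
    refine Summable.of_norm_bounded ((summable_expX (deltaU_pos d ha) (blk n p')).mul_left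
      (cG0 d * cKL d (d - 2) * ((n : ℝ) + 1) ^ 2 * cG d a)) fun y => ?_
    rw [Real.norm_eq_abs, abs_mul]
    have hK : 0 ≤ cG0 d * cKL d (d - 2) * ((n : ℝ) + 1) ^ 2 := by
      have := cG0_nonneg d; have := one_le_cKL d (d - 2); positivity
    calc |blockPot n q y| * |gq n a p' y|
        ≤ (cG0 d * cKL d (d - 2) * ((n : ℝ) + 1) ^ 2) * (cG d a * Real.exp (-(deltaU d a * dist (blk n p') y))) :=
          mul_le_mul (abs_blockPot_le hd n q y) (abs_gq_le_sup hd n ha p' y) (abs_nonneg _) hK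
      _ = _ := by ring
  have hts : ∑' y : X d, blockPot n q y * (gq n a (p + e μ) y - gq n a p y)
      = ∑' y : X d, blockPot n q y * gq n a (p + e μ) y - ∑' y : X d, blockPot n q y * gq n a p y := by
    rw [← (hsum (p + e μ)).tsum_sub (hsum p)]
    exact tsum_congr fun y => by ring
  have hdiff : (Gk n a (p + e μ) q - Gk n a p q) - (G₀ (p + e μ - q) - G₀ (p - q)) / ((n : ℝ) + 1) ^ 2
      = -(a / ((n : ℝ) + 1) ^ (d + 2) * ∑' y : X d, blockPot n q y * (gq n a (p + e μ) y - gq n a p y)) := by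
    rw [hts, Gk_eq_free_sub hd n ha (p + e μ) q, Gk_eq_free_sub hd n ha p q]; ring
  have hK : 0 ≤ cG d a / ((n : ℝ) + 1) := div_nonneg (cG_pos d ha).le hs.le
  have h := abs_tsum_blockPot_mul_le hd n ha p q hK (fun y => abs_gq_diff_le_sup hd n ha p y μ)
  rw [hdiff, abs_neg, abs_mul, abs_div, abs_of_pos ha, abs_of_pos (pow_pos hs _)]
  calc a / ((n : ℝ) + 1) ^ (d + 2) * |∑' y : X d, blockPot n q y * (gq n a (p + e μ) y - gq n a p y)|
      ≤ a / ((n : ℝ) + 1) ^ (d + 2) * (cG0 d * cKL d (d - 2) * ((n : ℝ) + 1) ^ 2 * (cG d a / ((n : ℝ) + 1))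
          * latticeConst d (deltaU d a)) := mul_le_mul_of_nonneg_left h (by positivity)
    _ = cSplit d a / ((n : ℝ) + 1) ^ (d + 1) := by rw [cSplit, pow_add, pow_succ]; field_simp; ring

end

end Summit.QuantumFields.BalabanUV.Beta.D1BFx.PointColumnSplit
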